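import Literature.AnabelianGeometry.EtaleTheta.Discharge.Sec5RootOfRootModel

/-!
# [EtTh] Prop. 5.2 (i) at the canonical model for GIVEN sections over a GIVEN covering: the pair `(s, τ)`
# constitutes an `N`-th root (resp. an `l·N`-th root) of the fraction-pair — no covering law needed

Mochizuki, *The étale theta function and its Frobenioid-theoretic manifestations*, Publ. RIMS **45** (2009),
Prop. 5.2 (i) p. 324 (PDF p. 98): «The pair of morphisms of `C` determined by "`s_{l·N}`", "`τ_{l·N}`" [cf. (1), (2):
the pull-backs to `Z̈_{l·N}` of the section `s_{l·N}` of Proposition 1.1, (i) and of the theta trivialization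
`τ_{l·N}` of Lemma 1.2, morphisms `V(O_{Z̈_{l·N}}) → V(L̈_{l·N}|_{Z̈_{l·N}})`] constitutes an `l·N`-th root of a right
fraction-pair … of … `Θ̈` …, or, alternatively, an `N`-th root of a right fraction-pair … of … an `l`-th root of
… `Θ̈` [cf. Remark 4.3.2]», proof: «These assertions follow immediately from the definitions. In the case of
assertion (i), we observe that the "(l·N, H_⊙, f|_{A_{l·N}})-saturated-ness" condition of Proposition 4.2, (iii),
follows immediately from the definition of the field `J̈_{l·N}` in §1» [cite: MochizukiEtTh2009, Prop 5.2 (i) p.324 (PDF p.98)].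

abc-iut cell, layer L2, PROOF-ONLY companion (0 `def`s; seat abc-iut-w5-d134 gen 4) of
`Discharge/Sec5RootOfRootModel.lean` (p433723) / `Sec5RootOfRootModelComp.lean` (p433882) — there the `N`-domain
is CHOSEN through the covering laws `hR`/`hE₂`; here it is GIVEN, which is print's own shape: the covering object
(`V(O_{Z̈_{l·N}})`), the root `g` (`s · τ⁻¹`) and the sections `(s, τ)` with their divisors are data, and the
level-`l·N` saturation clauses are properties OF THAT OBJECT («definition of `J̈_{l·N}`»).  Consumer: a successor
of abc-iut-L2-t4 assembling `ThetaFrobenioid.ofSetting` from abc-iut-L2-t1's §1 sections.  Nothing landed is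
edited or restated; no covering law (`hR`, `hE`, `hE₂`) is a hypothesis here.

* `exists_rootSquares_of_cover_mkOfModelCanonical` — at `S := mkOfModelCanonical X tf … A₀ …`: for a
  Frobenius-trivial `A` with Galois base, `f ∈ O^×(A^birat)` fixed by `H_A`, a right fraction-pair `P : A → B` of
  `f`; a pull-back morphism `φ : A_N → A` from a Frobenius-trivial Galois `μ_N`-saturated `A_N` satisfying Def. 4.1
  (iii)(a) at level `N`, with `A_N = A` whenever `A_N^bs ≅ A^bs`; an `N`-th root `g` of `f|_{A_N}`; and a right
  fraction-pair `Q = (s, τ) : A_N → B_N` of `g` with `N·Div(s) = φ^*Div(P.num)`, `N·Div(τ) = φ^*Div(P.den)` —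
  there are isometries `α : A_N → A` (carrying data of base-Frobenius type, pull-back part over `Base φ`),
  `β : B_N → B` of Frobenius degree `N` completing the two squares, with `A_N` `(N, H_⊙, (α')^*f)`-saturated.
* `pairIsNthRootOf_of_cover_mkOfModelCanonical` — hence `(s, τ)` «constitutes an `N`-th root of the right
  fraction-pair `P`» (`PairIsNthRootOf`).
* `pairIsNthRootOf_mul_of_cover_mkOfModelCanonical` — for `A := Rl.AN`, `f := Rl.root` (an `l`-th root datum of
  `Θ̈`'s pair) and a covering `A_N` of `A_l` in a skeleton through `A_⊙` carrying the level-`l·N` clauses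
  (`μ_{l·N}`-saturation; Def. 4.1 (iii)(a) at `l·N` and at `N`): BOTH printed alternatives for the given pair,
  `PairIsNthRootOf (l·N) θ s τ ∧ PairIsNthRootOf N f_l s τ` (first via this lineage's p427648).

HONEST FRAMING: kernel-checked consequences for data so typed, modulo `Φ` divisorial and the Def. 4.1 (ii)
naturality law `hS`; nothing asserts that such data exist for an actual curve; no side is taken on [IUTchIII]
Cor. 3.12.
-/

noncomputable section

namespace Literature.AnabelianGeometry.EtaleTheta

open CategoryTheory Opposite Literature.AlgebraicGeometry.Frobenioids

universe u₀ v₀ u v w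

namespace BiKummerSetting

section Canonical

variable {K : Type u₀} [Field K] (X : SemiGraphs.TemperedArithmeticGroup.{u₀} K) {D₀ : Type u₀}
  [Category.{v₀} D₀] {V : FrdIMonoidStub.{w}} {T : RealifiedDivisorMonoids (D₀ := D₀) V}
  {D : Type u} [Category.{v} D] {VD : FrdICatStub.{u, v, w} D}
  (tf : TemperedFrobenioid T D VD) (hZ : tf.monoidType = MonoidType.Z)
  (hP : ∀ A : Dᵒᵖ, IsPerfect (tf.Φ.carrier A)) (IG : D → Prop) (gS : ∀ A : D, IG A → (X.Pi →* Aut A))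
  (gSs : ∀ (A : D) (h : IG A), Function.Surjective (gS A h))
  (NH : Subgroup (Field.absoluteGaloisGroup K) → tf.category → ℕ+ → Prop) (A₀ : tf.category)
  (hA₀ : PreFrobenioid.IsFrobeniusTrivial tf.toElem A₀) (hA₀' : IG A₀.base)
  (hΦd : Objectwise (fun M _ => IsDivisorial M) tf.divisorMonoid)

include hΦd in
/-- **The two root squares over a GIVEN covering and GIVEN sections** ([EtTh] Prop. 4.2 (iii) data, p. 314, with
the `N`-domain prescribed): see the module docstring.  `α := F(N)_{A_N} ≫ φ′` with `φ′` the `P`-arrow over `Base φ`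
of the model's base-Frobenius pair through `A_N`, `A` (L03′ in the instance with distinguished object `A`), `β`
from L04 there; `H_{A_N}`-fixedness of `f|_{A_N}` by `isFixedByHA_pullFracModel`.
[cite: MochizukiEtTh2009, Prop 4.2 (iii) p.314 (PDF p.88)] -/
theorem exists_rootSquares_of_cover_mkOfModelCanonical
    (hS : ∀ ⦃A B : D⦄ (hA : IG A) (hB : IG B) (b : B ⟶ A),
      ∃ c : X.Pi, ∀ g : X.Pi, (gS B hB g).hom ≫ b = b ≫ (gS A hA (c * g * c⁻¹)).hom)
    {A B : tf.category} (hAft : PreFrobenioid.IsFrobeniusTrivial tf.toElem A) (hAG : IG A.base)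
    {f : tf.biratUnitsModel A} (hfix : (mkOfModelCanonical X tf hZ hP IG gS gSs NH A₀ hA₀ hA₀').IsFixedByHA A hAG f)
    (P : (mkOfModelCanonical X tf hZ hP IG gS gSs NH A₀ hA₀ hA₀').FractionPair f B) (N : ℕ+)
    {AN BN : tf.category} (φ : AN ⟶ A) (hφ : PreFrobenioid.IsPullbackMorphism tf.toElem φ)
    (hft : PreFrobenioid.IsFrobeniusTrivial tf.toElem AN) (hG : IG AN.base)
    (hsk₁ : Nonempty (AN.base ≅ A.base) → AN = A) (hμN : tf.IsMuSaturated AN N)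
    (hcN : ∃ (A₁ A₂ : tf.category) (s₁ : A₁ ⟶ AN) (s₂ : A₁ ⟶ A₂),
      (mkOfModelCanonical X tf hZ hP IG gS gSs NH A₀ hA₀ hA₀').IsPreStep s₁ ∧
        (mkOfModelCanonical X tf hZ hP IG gS gSs NH A₀ hA₀ hA₀').IsPreStep s₂ ∧
          (mkOfModelCanonical X tf hZ hP IG gS gSs NH A₀ hA₀ hA₀').IsFrobeniusTrivial A₂ ∧
            (mkOfModelCanonical X tf hZ hP IG gS gSs NH A₀ hA₀ hA₀').IsNHSaturatedBsFld
              (mkOfModelCanonical X tf hZ hP IG gS gSs NH A₀ hA₀ hA₀').HodotBsFld A₂ N)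
    {gN : tf.biratUnitsModel AN} (hgN : gN ^ (N : ℕ) = tf.pullFracModel φ f)
    (Q : (mkOfModelCanonical X tf hZ hP IG gS gSs NH A₀ hA₀ hA₀').FractionPair gN BN)
    (hQn : ModelFrobenioid.div Q.num ^ (N : ℕ) =
      pull tf.divisorMonoid (ModelFrobenioid.baseMap φ) (ModelFrobenioid.div P.num))
    (hQd : ModelFrobenioid.div Q.den ^ (N : ℕ) =
      pull tf.divisorMonoid (ModelFrobenioid.baseMap φ) (ModelFrobenioid.div P.den)) :
    ∃ (α : AN ⟶ A) (β : BN ⟶ B) (d : (mkOfModelCanonical X tf hZ hP IG gS gSs NH A₀ hA₀ hA₀').BaseFrobeniusTypeData α),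
      (mkOfModelCanonical X tf hZ hP IG gS gSs NH A₀ hA₀ hA₀').IsIsometry α ∧
        (mkOfModelCanonical X tf hZ hP IG gS gSs NH A₀ hA₀ hA₀').IsIsometry β ∧
          (mkOfModelCanonical X tf hZ hP IG gS gSs NH A₀ hA₀ hA₀').degFr α = N ∧
            (mkOfModelCanonical X tf hZ hP IG gS gSs NH A₀ hA₀ hA₀').degFr β = N ∧
              Q.num ≫ β = α ≫ P.num ∧ Q.den ≫ β = α ≫ P.den ∧
                ModelFrobenioid.baseMap d.α₁ = ModelFrobenioid.baseMap φ ∧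
                  gN ^ (N : ℕ) = tf.pullFracModel d.α₁ f ∧
                    (mkOfModelCanonical X tf hZ hP IG gS gSs NH A₀ hA₀ hA₀').IsSaturated AN N (tf.pullFracModel d.α₁ f) := by
  have hBg := tf.isGroupLike_ratFnFunctor T.isUnit_BΛ
  have hamp : (mkOfModelCanonical X tf hZ hP IG gS gSs NH A₀ hA₀ hA₀').IsAmple AN :=
    (mkOfModelCanonical X tf hZ hP IG gS gSs NH A₀ hA₀ hA₀').isAmple_of_isFrobeniusTrivial hBg hft hG
  have hampA : (mkOfModelCanonical X tf hZ hP IG gS gSs NH A₀ hA₀ hA₀').IsAmple A :=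
    (mkOfModelCanonical X tf hZ hP IG gS gSs NH A₀ hA₀ hA₀').isAmple_of_isFrobeniusTrivial hBg hAft hAG
  -- L03′ in the instance with distinguished object `A`: the base-Frobenius-type lift of `φ` up to a unit
  obtain ⟨s, hs, α, dA, hd, hiso, hdeg⟩ := Prop42Sub.baseFrobeniusLiftUpToUnit_mkOfModelCanonical X tf hZ hP IG gS
    gSs NH A hAft hAG hΦd N AN φ hsk₁ hφ hft hG hμN
  have hb₁ : ModelFrobenioid.baseMap dA.α₁ = ModelFrobenioid.baseMap φ := by
    have hb : ModelFrobenioid.baseMap s.hom = 𝟙 _ := hs.1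
    have h0 : ModelFrobenioid.baseMap dA.α₁ = ModelFrobenioid.baseMap (s.hom ≫ φ) :=
      congrArg ModelFrobenioid.baseMap hd
    rw [h0, ModelFrobenioid.baseMap_comp, hb, Category.id_comp]
  have hpf : tf.pullFracModel dA.α₁ f = tf.pullFracModel φ f :=
    DFunLike.congr_fun (tf.pullFracModel_eq_of_baseMap_eq hb₁) f
  have hgN' : gN ^ (N : ℕ) = tf.pullFracModel dA.α₁ f := by
    rw [hpf]
    exact hgN
  have hQn' : ModelFrobenioid.div Q.num ^ (N : ℕ) =
      pull tf.divisorMonoid (ModelFrobenioid.baseMap dA.α₁) (ModelFrobenioid.div P.num) := by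
    rw [hb₁]
    exact hQn
  have hQd' : ModelFrobenioid.div Q.den ^ (N : ℕ) =
      pull tf.divisorMonoid (ModelFrobenioid.baseMap dA.α₁) (ModelFrobenioid.div P.den) := by
    rw [hb₁]
    exact hQd
  -- L04 there (fraction-pairs carried field by field between the two instances of the same tempered Frobenioid)
  obtain ⟨β, hβiso, hβdeg, hcn, hcd⟩ := rootSquares_mkOfModel tf hZ hP T.isUnit_BΛ _ IG gS gSs NH _ A hAft hAG f
    (⟨P.num, P.den, P.isPreStep_num, P.isPreStep_den, P.base_eq, P.frac_eq, P.disjointSupports⟩ :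
      (mkOfModelCanonical X tf hZ hP IG gS gSs NH A hAft hAG).FractionPair f B)
    N AN α dA gN BN
    (⟨Q.num, Q.den, Q.isPreStep_num, Q.isPreStep_den, Q.base_eq, Q.frac_eq, Q.disjointSupports⟩ :
      (mkOfModelCanonical X tf hZ hP IG gS gSs NH A hAft hAG).FractionPair gN BN)
    hiso hdeg hgN' hQn' hQd'
  exact ⟨α, β, ⟨dA.G, dA.G_le, dA.α₂, dA.α₁, dA.fac, dA.isFrobeniusTrivial, dA.isGalois, dA.isMuSaturated,
      dA.mapsIsomorphically, dA.cond_c, dA.cond_d, dA.cond_e⟩, hiso, hβiso, hdeg, hβdeg, hcn, hcd, hb₁, hgN',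
    ⟨hamp, isFixedByHA_pullFracModel X tf hZ hP IG gS gSs NH A₀ hA₀ hA₀' hS hampA hfix hG dA.α₁, hcN, gN, hgN'⟩⟩

include hΦd in
/-- **[EtTh] Prop. 5.2 (i) shape for GIVEN sections — «the pair `(s, τ)` constitutes an `N`-th root of the
right fraction-pair `P`»** (`PairIsNthRootOf`, Prop. 4.2 (iii)), for the data of
`exists_rootSquares_of_cover_mkOfModelCanonical`.  [cite: MochizukiEtTh2009, Prop 5.2 (i) p.324 (PDF p.98)] -/
theorem pairIsNthRootOf_of_cover_mkOfModelCanonical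
    (hS : ∀ ⦃A B : D⦄ (hA : IG A) (hB : IG B) (b : B ⟶ A),
      ∃ c : X.Pi, ∀ g : X.Pi, (gS B hB g).hom ≫ b = b ≫ (gS A hA (c * g * c⁻¹)).hom)
    {A B : tf.category} (hAft : PreFrobenioid.IsFrobeniusTrivial tf.toElem A) (hAG : IG A.base)
    {f : tf.biratUnitsModel A} (hfix : (mkOfModelCanonical X tf hZ hP IG gS gSs NH A₀ hA₀ hA₀').IsFixedByHA A hAG f)
    (P : (mkOfModelCanonical X tf hZ hP IG gS gSs NH A₀ hA₀ hA₀').FractionPair f B) (N : ℕ+)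
    {AN BN : tf.category} (φ : AN ⟶ A) (hφ : PreFrobenioid.IsPullbackMorphism tf.toElem φ)
    (hft : PreFrobenioid.IsFrobeniusTrivial tf.toElem AN) (hG : IG AN.base)
    (hsk₁ : Nonempty (AN.base ≅ A.base) → AN = A) (hμN : tf.IsMuSaturated AN N)
    (hcN : ∃ (A₁ A₂ : tf.category) (s₁ : A₁ ⟶ AN) (s₂ : A₁ ⟶ A₂),
      (mkOfModelCanonical X tf hZ hP IG gS gSs NH A₀ hA₀ hA₀').IsPreStep s₁ ∧
        (mkOfModelCanonical X tf hZ hP IG gS gSs NH A₀ hA₀ hA₀').IsPreStep s₂ ∧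
          (mkOfModelCanonical X tf hZ hP IG gS gSs NH A₀ hA₀ hA₀').IsFrobeniusTrivial A₂ ∧
            (mkOfModelCanonical X tf hZ hP IG gS gSs NH A₀ hA₀ hA₀').IsNHSaturatedBsFld
              (mkOfModelCanonical X tf hZ hP IG gS gSs NH A₀ hA₀ hA₀').HodotBsFld A₂ N)
    {gN : tf.biratUnitsModel AN} (hgN : gN ^ (N : ℕ) = tf.pullFracModel φ f)
    (Q : (mkOfModelCanonical X tf hZ hP IG gS gSs NH A₀ hA₀ hA₀').FractionPair gN BN)
    (hQn : ModelFrobenioid.div Q.num ^ (N : ℕ) =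
      pull tf.divisorMonoid (ModelFrobenioid.baseMap φ) (ModelFrobenioid.div P.num))
    (hQd : ModelFrobenioid.div Q.den ^ (N : ℕ) =
      pull tf.divisorMonoid (ModelFrobenioid.baseMap φ) (ModelFrobenioid.div P.den)) :
    (mkOfModelCanonical X tf hZ hP IG gS gSs NH A₀ hA₀ hA₀').PairIsNthRootOf (fun {_ _} φ x => tf.pullFracModel φ x)
      (N : ℕ) f Q.num Q.den := by
  obtain ⟨α, β, d, hiso, hβiso, hdeg, hβdeg, hcn, hcd, -, hg, hsat⟩ :=
    exists_rootSquares_of_cover_mkOfModelCanonical X tf hZ hP IG gS gSs NH A₀ hA₀ hA₀' hΦd hS hAft hAG hfix P N φ hφ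
      hft hG hsk₁ hμN hcN hgN Q hQn hQd
  exact (mkOfModelCanonical X tf hZ hP IG gS gSs NH A₀ hA₀ hA₀').pairIsNthRootOf_nthRoot
    (fun {_ _} φ x => tf.pullFracModel φ x)
    ({ AN := AN, BN := BN, α := α, β := β, root := gN, pair := Q, comm_num := hcn, comm_den := hcd,
       isIsometry := ⟨hiso, hβiso, hdeg, hβdeg⟩, αData := d, pow_root := hg, isSaturated := hsat } :
      (mkOfModelCanonical X tf hZ hP IG gS gSs NH A₀ hA₀ hA₀').NthRoot f P N (fun {_} φ x => tf.pullFracModel φ x))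

include hΦd in
/-- **[EtTh] Prop. 5.2 (i), BOTH printed alternatives, for GIVEN sections over a GIVEN covering of the
`l`-domain** — print's shape: `(s, τ) := (s_{l·N}, τ_{l·N})` over `A_N := V(O_{Z̈_{l·N}})`, with `A_N` in a skeleton
through `A_⊙` (`hsk₀`) and through `A_l` (`hsk₁`), `μ_{l·N}`-saturated (`hμ`) and satisfying Def. 4.1 (iii)(a) at
levels `l·N` (`hcondA`) and `N` (`hcN`) — «follows immediately from the definition of the field `J̈_{l·N}`»; the
root `g_N` of `f_l|_{A_N}` and the divisor bookkeeping of `(s, τ)` are the §1 computations.  Then `(s, τ)` is an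
`l·N`-th root of `θ`'s pair (this lineage's `pairIsNthRootOf_comp_mkOfModelCanonical`, p427648) AND an `N`-th
root of the `l`-th root's pair.  [cite: MochizukiEtTh2009, Prop 5.2 (i) p.324 (PDF p.98)] -/
theorem pairIsNthRootOf_mul_of_cover_mkOfModelCanonical
    (hS : ∀ ⦃A B : D⦄ (hA : IG A) (hB : IG B) (b : B ⟶ A),
      ∃ c : X.Pi, ∀ g : X.Pi, (gS B hB g).hom ≫ b = b ≫ (gS A hA (c * g * c⁻¹)).hom)
    {Bl : tf.category} {θ : tf.biratUnitsModel A₀}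
    {Pl : (mkOfModelCanonical X tf hZ hP IG gS gSs NH A₀ hA₀ hA₀').FractionPair θ Bl} {lv : ℕ+}
    (Rl : (mkOfModelCanonical X tf hZ hP IG gS gSs NH A₀ hA₀ hA₀').NthRoot θ Pl lv
      (fun {_} φ x => tf.pullFracModel φ x))
    (hfixl : (mkOfModelCanonical X tf hZ hP IG gS gSs NH A₀ hA₀ hA₀').IsFixedByHA Rl.AN Rl.αData.isGalois Rl.root)
    (N : ℕ+) {AN BN : tf.category} (φ : AN ⟶ Rl.AN) (hφ : PreFrobenioid.IsPullbackMorphism tf.toElem φ)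
    (hft : PreFrobenioid.IsFrobeniusTrivial tf.toElem AN) (hG : IG AN.base)
    (hsk₀ : Nonempty (AN.base ≅ A₀.base) → AN = A₀) (hsk₁ : Nonempty (AN.base ≅ Rl.AN.base) → AN = Rl.AN)
    (hμ : tf.IsMuSaturated AN (lv * N))
    (hcondA : ∃ (A₁ A₂ : tf.category) (s₁ : A₁ ⟶ AN) (s₂ : A₁ ⟶ A₂),
      (mkOfModelCanonical X tf hZ hP IG gS gSs NH A₀ hA₀ hA₀').IsPreStep s₁ ∧
        (mkOfModelCanonical X tf hZ hP IG gS gSs NH A₀ hA₀ hA₀').IsPreStep s₂ ∧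
          (mkOfModelCanonical X tf hZ hP IG gS gSs NH A₀ hA₀ hA₀').IsFrobeniusTrivial A₂ ∧
            (mkOfModelCanonical X tf hZ hP IG gS gSs NH A₀ hA₀ hA₀').IsNHSaturatedBsFld
              (mkOfModelCanonical X tf hZ hP IG gS gSs NH A₀ hA₀ hA₀').HodotBsFld A₂ (lv * N))
    (hcN : ∃ (A₁ A₂ : tf.category) (s₁ : A₁ ⟶ AN) (s₂ : A₁ ⟶ A₂),
      (mkOfModelCanonical X tf hZ hP IG gS gSs NH A₀ hA₀ hA₀').IsPreStep s₁ ∧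
        (mkOfModelCanonical X tf hZ hP IG gS gSs NH A₀ hA₀ hA₀').IsPreStep s₂ ∧
          (mkOfModelCanonical X tf hZ hP IG gS gSs NH A₀ hA₀ hA₀').IsFrobeniusTrivial A₂ ∧
            (mkOfModelCanonical X tf hZ hP IG gS gSs NH A₀ hA₀ hA₀').IsNHSaturatedBsFld
              (mkOfModelCanonical X tf hZ hP IG gS gSs NH A₀ hA₀ hA₀').HodotBsFld A₂ N)
    {gN : tf.biratUnitsModel AN} (hgN : gN ^ (N : ℕ) = tf.pullFracModel φ Rl.root)
    (Q : (mkOfModelCanonical X tf hZ hP IG gS gSs NH A₀ hA₀ hA₀').FractionPair gN BN)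
    (hQn : ModelFrobenioid.div Q.num ^ (N : ℕ) =
      pull tf.divisorMonoid (ModelFrobenioid.baseMap φ) (ModelFrobenioid.div Rl.pair.num))
    (hQd : ModelFrobenioid.div Q.den ^ (N : ℕ) =
      pull tf.divisorMonoid (ModelFrobenioid.baseMap φ) (ModelFrobenioid.div Rl.pair.den)) :
    (mkOfModelCanonical X tf hZ hP IG gS gSs NH A₀ hA₀ hA₀').PairIsNthRootOf (fun {_ _} φ x => tf.pullFracModel φ x)
        ((lv : ℕ) * N) θ Q.num Q.den ∧
      (mkOfModelCanonical X tf hZ hP IG gS gSs NH A₀ hA₀ hA₀').PairIsNthRootOf (fun {_ _} φ x => tf.pullFracModel φ x)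
        (N : ℕ) Rl.root Q.num Q.den := by
  have hμN : tf.IsMuSaturated AN N := hμ.of_dvd (by rw [PNat.mul_coe]; exact Dvd.intro_left _ rfl)
  obtain ⟨α, β, d, hiso, hβiso, hdeg, hβdeg, hcn, hcd, -, hg, hsat⟩ :=
    exists_rootSquares_of_cover_mkOfModelCanonical X tf hZ hP IG gS gSs NH A₀ hA₀ hA₀' hΦd hS
      Rl.αData.isFrobeniusTrivial Rl.αData.isGalois hfixl Rl.pair N φ hφ hft hG hsk₁ hμN hcN hgN Q hQn hQd
  let R : (mkOfModelCanonical X tf hZ hP IG gS gSs NH A₀ hA₀ hA₀').NthRoot Rl.root Rl.pair N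
      (fun {_} φ x => tf.pullFracModel φ x) :=
    { AN := AN, BN := BN, α := α, β := β, root := gN, pair := Q, comm_num := hcn, comm_den := hcd,
      isIsometry := ⟨hiso, hβiso, hdeg, hβdeg⟩, αData := d, pow_root := hg, isSaturated := hsat }
  exact ⟨pairIsNthRootOf_comp_mkOfModelCanonical X tf hZ hP IG gS gSs NH A₀ hA₀ hA₀' hΦd Rl R hsk₀ hμ hcondA,
    (mkOfModelCanonical X tf hZ hP IG gS gSs NH A₀ hA₀ hA₀').pairIsNthRootOf_nthRoot
      (fun {_ _} φ x => tf.pullFracModel φ x) R⟩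


/-! ### v2 (append-only): the `l`-th root carried by `A_⊙` itself — the double-underline reading -/

/-- **Every `f ∈ O^×(A_⊙^birat)` is fixed by `H_{A_⊙}`** (Def. 4.1 (ii)/(iii) at the distinguished object):
`H_⊙ = Ker(Π^tp_X ↠ Aut_D(A_⊙^bs))`, so an element of `H_{A_⊙}` has identity base component, and the action of
`Aut_C(A_⊙)` on `O^×(A_⊙^birat) = B(A_⊙^bs)^×` factors through `Base`.  [cite: MochizukiEtTh2009, Def 4.1 (ii) p.313 (PDF p.87)] -/
theorem isFixedByHA_Aodot_mkOfModelCanonical (f : tf.biratUnitsModel A₀) :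
    (mkOfModelCanonical X tf hZ hP IG gS gSs NH A₀ hA₀ hA₀').IsFixedByHA A₀ hA₀' f := by
  intro σ hσ
  obtain ⟨h, hh, hσh⟩ := Subgroup.mem_map.1 (inv_mem hσ)
  have hker : gS A₀.base hA₀' h = 1 := hh
  have hbase : ModelFrobenioid.baseMap σ.inv = 𝟙 _ := by
    have e : ModelFrobenioid.baseMap σ.inv = (gS A₀.base hA₀' h).hom := (congrArg Iso.hom hσh).symm
    rw [e, hker]
    rfl
  apply Units.ext
  change ((tf.biratAutModel A₀ σ f : tf.biratUnitsModel A₀) : tf.ratFnFunctor.obj (op A₀.base)) =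
    ((f : tf.biratUnitsModel A₀) : tf.ratFnFunctor.obj (op A₀.base))
  rw [TemperedFrobenioid.coe_biratAutModel_apply, hbase, op_id, CategoryTheory.Functor.map_id]
  rfl

include hΦd in
/-- **[EtTh] Prop. 5.2 (i), BOTH printed alternatives, in the DOUBLE-UNDERLINE reading, assembled from §1-type
inputs only** (v2): the `l`-th root `f_l = Θ̲ = Θ̈^{1/l}` is a birational unit ON `A_⊙` itself (`A_⊙^bs = Ÿ̲`,
[IUTchI] Ex. 3.2) with `f_l^l = θ` and its right fraction-pair `Pl : A_⊙ → B_l` satisfying `l·Div(s′_l) = Div(s′)`,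
`l·Div(s″_l) = Div(s″)`; `A_⊙` is `μ_l`-saturated and satisfies Def. 4.1 (iii)(a) at level `l`; the level-`N` data are
a covering `φ : A_N → A_⊙` (`A_N := V(O_{Z̈_{l·N}})`: Frobenius-trivial, Galois, `A_N = A_⊙` if `A_N^bs ≅ A_⊙^bs`,
`μ_{l·N}`-saturated, Def. 4.1 (iii)(a) at `l·N` and at `N`), a root `g_N` of `f_l|_{A_N}` and the sections `Q = (s, τ)`,
a right fraction-pair of `g_N` with `N·Div(s) = φ^*Div(s′_l)`, `N·Div(τ) = φ^*Div(s″_l)`.  Then `(s, τ)` «constitutes an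
`l·N`-th root of a right fraction-pair of `Θ̈`, or, alternatively, an `N`-th root of a right fraction-pair of an
`l`-th root of `Θ̈`» — the `l`-th root datum over `A_⊙` (`α_l := F(l)_{A_⊙} ≫` a unit, `β_l`) is built by
`exists_rootSquares_of_cover_mkOfModelCanonical` with the identity covering, `H_{A_⊙}`-fixedness of `f_l` is
`isFixedByHA_Aodot_mkOfModelCanonical`.  Modulo `Φ` divisorial and `hS` only.
[cite: MochizukiEtTh2009, Prop 5.2 (i) p.324 (PDF p.98)] -/
theorem pairIsNthRootOf_mul_of_rootOnAodot_mkOfModelCanonical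
    (hS : ∀ ⦃A B : D⦄ (hA : IG A) (hB : IG B) (b : B ⟶ A),
      ∃ c : X.Pi, ∀ g : X.Pi, (gS B hB g).hom ≫ b = b ≫ (gS A hA (c * g * c⁻¹)).hom)
    {B Bl : tf.category} {θ : tf.biratUnitsModel A₀}
    (P : (mkOfModelCanonical X tf hZ hP IG gS gSs NH A₀ hA₀ hA₀').FractionPair θ B) (lv : ℕ+)
    {fl : tf.biratUnitsModel A₀} (hfl : fl ^ (lv : ℕ) = θ)
    (Pl : (mkOfModelCanonical X tf hZ hP IG gS gSs NH A₀ hA₀ hA₀').FractionPair fl Bl)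
    (hPln : ModelFrobenioid.div Pl.num ^ (lv : ℕ) = ModelFrobenioid.div P.num)
    (hPld : ModelFrobenioid.div Pl.den ^ (lv : ℕ) = ModelFrobenioid.div P.den)
    (hμl : tf.IsMuSaturated A₀ lv)
    (hcl : ∃ (A₁ A₂ : tf.category) (s₁ : A₁ ⟶ A₀) (s₂ : A₁ ⟶ A₂),
      (mkOfModelCanonical X tf hZ hP IG gS gSs NH A₀ hA₀ hA₀').IsPreStep s₁ ∧
        (mkOfModelCanonical X tf hZ hP IG gS gSs NH A₀ hA₀ hA₀').IsPreStep s₂ ∧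
          (mkOfModelCanonical X tf hZ hP IG gS gSs NH A₀ hA₀ hA₀').IsFrobeniusTrivial A₂ ∧
            (mkOfModelCanonical X tf hZ hP IG gS gSs NH A₀ hA₀ hA₀').IsNHSaturatedBsFld
              (mkOfModelCanonical X tf hZ hP IG gS gSs NH A₀ hA₀ hA₀').HodotBsFld A₂ lv)
    (N : ℕ+) {AN BN : tf.category} (φ : AN ⟶ A₀) (hφ : PreFrobenioid.IsPullbackMorphism tf.toElem φ)
    (hft : PreFrobenioid.IsFrobeniusTrivial tf.toElem AN) (hG : IG AN.base)
    (hsk₀ : Nonempty (AN.base ≅ A₀.base) → AN = A₀) (hμ : tf.IsMuSaturated AN (lv * N))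
    (hcondA : ∃ (A₁ A₂ : tf.category) (s₁ : A₁ ⟶ AN) (s₂ : A₁ ⟶ A₂),
      (mkOfModelCanonical X tf hZ hP IG gS gSs NH A₀ hA₀ hA₀').IsPreStep s₁ ∧
        (mkOfModelCanonical X tf hZ hP IG gS gSs NH A₀ hA₀ hA₀').IsPreStep s₂ ∧
          (mkOfModelCanonical X tf hZ hP IG gS gSs NH A₀ hA₀ hA₀').IsFrobeniusTrivial A₂ ∧
            (mkOfModelCanonical X tf hZ hP IG gS gSs NH A₀ hA₀ hA₀').IsNHSaturatedBsFld
              (mkOfModelCanonical X tf hZ hP IG gS gSs NH A₀ hA₀ hA₀').HodotBsFld A₂ (lv * N))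
    (hcN : ∃ (A₁ A₂ : tf.category) (s₁ : A₁ ⟶ AN) (s₂ : A₁ ⟶ A₂),
      (mkOfModelCanonical X tf hZ hP IG gS gSs NH A₀ hA₀ hA₀').IsPreStep s₁ ∧
        (mkOfModelCanonical X tf hZ hP IG gS gSs NH A₀ hA₀ hA₀').IsPreStep s₂ ∧
          (mkOfModelCanonical X tf hZ hP IG gS gSs NH A₀ hA₀ hA₀').IsFrobeniusTrivial A₂ ∧
            (mkOfModelCanonical X tf hZ hP IG gS gSs NH A₀ hA₀ hA₀').IsNHSaturatedBsFld
              (mkOfModelCanonical X tf hZ hP IG gS gSs NH A₀ hA₀ hA₀').HodotBsFld A₂ N)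
    {gN : tf.biratUnitsModel AN} (hgN : gN ^ (N : ℕ) = tf.pullFracModel φ fl)
    (Q : (mkOfModelCanonical X tf hZ hP IG gS gSs NH A₀ hA₀ hA₀').FractionPair gN BN)
    (hQn : ModelFrobenioid.div Q.num ^ (N : ℕ) =
      pull tf.divisorMonoid (ModelFrobenioid.baseMap φ) (ModelFrobenioid.div Pl.num))
    (hQd : ModelFrobenioid.div Q.den ^ (N : ℕ) =
      pull tf.divisorMonoid (ModelFrobenioid.baseMap φ) (ModelFrobenioid.div Pl.den)) :
    (mkOfModelCanonical X tf hZ hP IG gS gSs NH A₀ hA₀ hA₀').PairIsNthRootOf (fun {_ _} φ x => tf.pullFracModel φ x)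
        ((lv : ℕ) * N) θ Q.num Q.den ∧
      (mkOfModelCanonical X tf hZ hP IG gS gSs NH A₀ hA₀ hA₀').PairIsNthRootOf (fun {_ _} φ x => tf.pullFracModel φ x)
        (N : ℕ) fl Q.num Q.den := by
  -- `B(id) = id` on birational units and divisors
  have hid : tf.pullFracModel (𝟙 A₀) θ = θ := by
    apply Units.ext
    rw [TemperedFrobenioid.coe_pullFracModel_apply, ModelFrobenioid.baseMap_id, op_id, CategoryTheory.Functor.map_id]
    rfl
  have hfl' : fl ^ (lv : ℕ) = tf.pullFracModel (𝟙 A₀) θ := by rw [hid]; exact hfl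
  have hPln' : ModelFrobenioid.div Pl.num ^ (lv : ℕ) =
      pull tf.divisorMonoid (ModelFrobenioid.baseMap (𝟙 A₀)) (ModelFrobenioid.div P.num) := by
    rw [ModelFrobenioid.baseMap_id, pull_id]; exact hPln
  have hPld' : ModelFrobenioid.div Pl.den ^ (lv : ℕ) =
      pull tf.divisorMonoid (ModelFrobenioid.baseMap (𝟙 A₀)) (ModelFrobenioid.div P.den) := by
    rw [ModelFrobenioid.baseMap_id, pull_id]; exact hPld
  -- the `l`-th root datum carried by `A_⊙` itself (identity covering)
  obtain ⟨αl, βl, dl, hisol, hβisol, hdegl, hβdegl, hcnl, hcdl, -, hgl, hsatl⟩ :=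
    exists_rootSquares_of_cover_mkOfModelCanonical X tf hZ hP IG gS gSs NH A₀ hA₀ hA₀' hΦd hS hA₀ hA₀'
      (isFixedByHA_Aodot_mkOfModelCanonical X tf hZ hP IG gS gSs NH A₀ hA₀ hA₀' θ) P lv (𝟙 A₀)
      (PreFrobenioid.isPullbackMorphism_of_isIso _ (𝟙 A₀)) hA₀ hA₀' (fun _ => rfl) hμl hcl hfl' Pl hPln' hPld'
  let Rl : (mkOfModelCanonical X tf hZ hP IG gS gSs NH A₀ hA₀ hA₀').NthRoot θ P lv (fun {_} φ x => tf.pullFracModel φ x) :=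
    { AN := A₀, BN := Bl, α := αl, β := βl, root := fl, pair := Pl, comm_num := hcnl, comm_den := hcdl,
      isIsometry := ⟨hisol, hβisol, hdegl, hβdegl⟩, αData := dl, pow_root := hgl, isSaturated := hsatl }
  exact pairIsNthRootOf_mul_of_cover_mkOfModelCanonical X tf hZ hP IG gS gSs NH A₀ hA₀ hA₀' hΦd hS Rl
    (isFixedByHA_Aodot_mkOfModelCanonical X tf hZ hP IG gS gSs NH A₀ hA₀ hA₀' fl) N φ hφ hft hG hsk₀ hsk₀ hμ hcondA
    hcN hgN Q hQn hQd

end Canonical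

end BiKummerSetting

end Literature.AnabelianGeometry.EtaleTheta

end
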